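import Mathlib
import Literature.Analysis.FluidPDE.SteadyNSLatticeLinearised
import Literature.Analysis.FluidPDE.TorusABCFlow
import Summits.NavierStokesRegularity.FluidComputer.AbcLyapunovInstability
import HarnessLib

/-!
# The skew-cut certifiers' operator IS the tree's linearised Navier–Stokes operator about the ABC
# flow: eigen synthesis on the Fourier lattice `ℤ³` (ASSEMBLY obligations (A6) + the operator half
# of (A2) of `HOME/instab4/KERNEL-CHAIN.md`; instab4 g5 — implementation 2 of the X0 chain,
# cell `ns-blowup`, 2026-08-26)

HONEST FRAMING (human ruling D-0035): nothing here is a claim about Navier–Stokes blow-up.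
WHAT THIS IS NOT: not NS evidence; MODEL lane (the linearisation of the forced Navier–Stokes
system about the exact steady ABC state). No certificate is moved by this file: it identifies, in
the kernel, the OPERATOR whose class-II Galerkin sections the two X0 certifiers (instab3 `i3cert`,
instab4 `cert.py`; selfsim/cap likewise) diagonalise — written by them on `(ℝ/2πℤ)³` with `ν = 1/R`
in the cross-product form `L_R c(k) = −(1/R)|k|² c(k) + P_k Σ_{k′} Û(k − k′) × (i k′ × c(k′) − c(k′))`
(METHOD-I4 §1: `⟨(x − L) f′e^{ik′·x}, f e^{ik·x}⟩ = −(Û(k − k′) × (ik′ × f′ − f′))·f`) — with the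
tree's classical linearised operator `L(ν, u_S) w = νΔw − (u_S·∇)w − (w·∇)u_S − ∇q` of
`Literature.Analysis.FluidPDE.Torus.IsLinNSEigenvalue` at `u_S = Torus.abcFlow A B C` on the UNIT
torus, after the rescaling `ν = 1/(2πR)`, `μ = 2πλ` recorded (as prose) in the docstring of
`AbcLyapunovInstability.isLyapunovUnstable_abcFlow_of_eigenvalue`.

* §1 `isLinNSEigenvalue_of_fourier_eigen` — GENERAL-`μ` EIGEN SYNTHESIS on `T³` about any smooth
  divergence-free `u₀`: a rapidly decaying, transversal, mean-zero Cartesian coefficient family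
  `c ≠ 0` solving the projected lattice eigen-equation
  `ν·4π²|k|² c(k) + Π_k (N(û₀, c) + N(c, û₀))(k) + μ c(k) = 0` (`Π = Torus.lerayCoeff`,
  `N = ScalarFourier.transportSym` componentwise) synthesises a classical eigenpair:
  `Torus.IsLinNSEigenvalue ν u₀ μ` (the tree had `μ = 0`: `SteadyLattice.isLinNSEigenvalue_of_fourier`;
  general `μ` through `SteadyLattice.linNSResolventRel_of_fourier` with right-hand side `g = μ w`).
* §2 `lerayCoeff_linSym_abcFlow` — for `u₀ = Torus.abcFlow A B C` the projected linearised symbol is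
  the cross-product form: `Π_k (N(û₀, c) + N(c, û₀))(k) = −2π · Π_k Σ_{s ∈ {±e_j}} Û(s) × (i(k − s) × c(k − s) − c(k − s))`
  (polarised Lamb identity `(U·∇)w + (w·∇)U = ∇(U·w) − U × curl w − w × curl U` at the symbol
  level = BAC–CAB per frequency pair, the Beltrami shell relation `i s × Û(s) = Û(s)`
  (`Torus.abcCoeff_eigen`), and `Π_k k = 0`).
* §3 `isLinNSEigenvalue_abcFlow_of_certifier_eigen` — the certifiers' eigen-equation
  `−(1/R)|k|² c(k) + Π_k Σ_s Û(s) × (i(k − s) × c(k − s) − c(k − s)) = λ c(k)` for a rapidly decaying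
  transversal `c ≠ 0` with `c 0 = 0` gives `Torus.IsLinNSEigenvalue (1/(2πR)) (Torus.abcFlow A B C) (2πλ)`;
  §4 `isLyapunovUnstable_abcFlow_of_certifier_eigen` — with `0 < Re λ` and the named fact FPS06,
  rung R-α (`AbcLyapunovInstability`).

What remains OUTSIDE the kernel for ⟦I-X0⟧ after this file: the class-II Craya ↔ Cartesian change of
coordinates of the certificate matrices (finite linear algebra per shell), the transcribed numbers
(CERTIFIER AUDIT), the pairing bound of (A4); see KERNEL-CHAIN.md §2.

Mathlib + the files named; no new definitions, no named facts.
-/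

noncomputable section

open scoped BigOperators ComplexConjugate Matrix
open Filter Set Function MeasureTheory UnitAddTorus

namespace Summit.NavierStokesRegularity.FluidComputer.AbcLatticeEigenSynthesis

open Literature.Analysis.FunctionSpaces Literature.Analysis.FunctionSpaces.Torus
open Literature.Analysis.FunctionSpaces.EuclideanSpace
open Literature.Analysis.FluidPDE Literature.Analysis.FluidPDE.ScalarFourier
open Literature.Analysis.FluidPDE.SteadyLattice

/-! ## §1 General-`μ` eigen synthesis on `T³` -/

/-- **General-`μ` eigen synthesis, with the synthesised field.** For smooth divergence-free `u₀`,
`μ ∈ ℂ`, and a rapidly decaying transversal Cartesian coefficient family `c` with `c 0 = 0` solving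
the projected lattice eigen-equation `ν·4π²|k|² c(k) + Π_k (N(û₀, c) + N(c, û₀))(k) + μ c(k) = 0`,
there is a classical solution `w` of `L(ν, u₀) w = μ w` (`Torus.LinNSResolventRel ν u₀ μ w 0`:
smooth, divergence free, mean zero, with a smooth pressure) with `𝓕 w = c`. -/
theorem linNSResolventRel_of_fourier_eigen {ν : ℝ}
    {u₀ : UnitAddTorus (Fin 3) → EuclideanSpace ℝ (Fin 3)} (hu₀ : IsSmooth u₀) (hdiv₀ : IsDivFree u₀)
    (μ : ℂ) {c : (Fin 3 → ℤ) → EuclideanSpace ℂ (Fin 3)} (hc : RapidDecay c)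
    (hct : ∀ k : Fin 3 → ℤ, (∑ jj : Fin 3, ((k jj : ℤ) : ℂ) * (c k) jj) = 0) (hc0 : c 0 = 0)
    (heq : ∀ k : Fin 3 → ℤ, (((ν * (4 * Real.pi ^ 2 * freqNormSq k)) : ℝ) : ℂ) • c k +
      Torus.lerayCoeff k ((WithLp.toLp 2 (fun pp : Fin 3 => transportSym (fun jj mm =>
          (mFourierCoeff (complexify ∘ u₀)) mm jj) (fun mm => c mm pp) k) : EuclideanSpace ℂ (Fin 3)) +
        (WithLp.toLp 2 (fun pp : Fin 3 => transportSym (fun jj mm => c mm jj) (fun mm =>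
          (mFourierCoeff (complexify ∘ u₀)) mm pp) k) : EuclideanSpace ℂ (Fin 3))) + μ • c k = 0) :
    ∃ w : UnitAddTorus (Fin 3) → EuclideanSpace ℂ (Fin 3),
      Torus.LinNSResolventRel ν u₀ μ w 0 ∧ mFourierCoeff w = c := by
  -- the right-hand side `g = μ • (fourierSynth c)`
  set w₀ : UnitAddTorus (Fin 3) → EuclideanSpace ℂ (Fin 3) := fourierSynth c with hw₀def
  have hw₀ : IsSmooth w₀ := hc.isSmooth_fourierSynth
  have hŵ₀ : ∀ k, mFourierCoeff w₀ k = c k := hc.mFourierCoeff_fourierSynth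
  set g : UnitAddTorus (Fin 3) → EuclideanSpace ℂ (Fin 3) := μ • w₀ with hgdef
  have hg : IsSmooth g := by
    change ContDiff ℝ _ (Torus.lift (μ • w₀))
    exact ContDiff.const_smul μ hw₀
  have hĝ : ∀ k, mFourierCoeff g k = μ • c k := fun k => by
    rw [hgdef, mFourierCoeff_const_smul, hŵ₀]
  have hg0 : mFourierCoeff g 0 = 0 := by rw [hĝ, hc0, smul_zero]
  -- the equation with right-hand side `-Π_k ĝ(k) = -μ • c k`
  have hPc : ∀ k, Torus.lerayCoeff k (c k) = c k := fun k => by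
    by_cases hk : k = 0
    · subst hk; rw [hc0, lerayCoeff_zero_vec]
    · exact lerayCoeff_of_kdot_eq_zero hk (hct k)
  have heq' : ∀ k : Fin 3 → ℤ, (((ν * (4 * Real.pi ^ 2 * freqNormSq k)) : ℝ) : ℂ) • c k +
      Torus.lerayCoeff k ((WithLp.toLp 2 (fun pp : Fin 3 => transportSym (fun jj mm =>
          (mFourierCoeff (complexify ∘ u₀)) mm jj) (fun mm => c mm pp) k) : EuclideanSpace ℂ (Fin 3)) +
        (WithLp.toLp 2 (fun pp : Fin 3 => transportSym (fun jj mm => c mm jj) (fun mm =>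
          (mFourierCoeff (complexify ∘ u₀)) mm pp) k) : EuclideanSpace ℂ (Fin 3))) =
      -Torus.lerayCoeff k (mFourierCoeff g k) := fun k => by
    rw [hĝ, lerayCoeff_smul', hPc, ← sub_eq_zero, sub_neg_eq_add]
    exact heq k
  obtain ⟨w, hw, hŵ⟩ := linNSResolventRel_of_fourier hu₀ hdiv₀ hg hg0 hc hct hc0 heq'
  refine ⟨w, ?_, hŵ⟩
  obtain ⟨hws, hwdiv, hwmean, q, hq, hwq⟩ := hw
  -- `w` is the synthesis of `c`
  have hww₀ : w = w₀ := hws.ext_mFourierCoeff hw₀ fun k => by rw [hŵ, hŵ₀]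
  refine ⟨hws, hwdiv, hwmean, q, hq, fun x => ?_⟩
  have h := hwq x
  rw [zero_smul, sub_zero] at h
  rw [Pi.zero_apply, h, hgdef, hww₀, Pi.smul_apply, sub_self]

/-- **General-`μ` eigen synthesis** (KERNEL-CHAIN (A6) in Cartesian lattice coordinates): under
the hypotheses of `linNSResolventRel_of_fourier_eigen` and `c ≠ 0`, `μ` is an eigenvalue of the
linearised Navier–Stokes operator at `u₀`: `Torus.IsLinNSEigenvalue ν u₀ μ`. -/
theorem isLinNSEigenvalue_of_fourier_eigen {ν : ℝ}
    {u₀ : UnitAddTorus (Fin 3) → EuclideanSpace ℝ (Fin 3)} (hu₀ : IsSmooth u₀) (hdiv₀ : IsDivFree u₀)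
    (μ : ℂ) {c : (Fin 3 → ℤ) → EuclideanSpace ℂ (Fin 3)} (hc : RapidDecay c)
    (hct : ∀ k : Fin 3 → ℤ, (∑ jj : Fin 3, ((k jj : ℤ) : ℂ) * (c k) jj) = 0) (hc0 : c 0 = 0)
    (hcne : c ≠ 0)
    (heq : ∀ k : Fin 3 → ℤ, (((ν * (4 * Real.pi ^ 2 * freqNormSq k)) : ℝ) : ℂ) • c k +
      Torus.lerayCoeff k ((WithLp.toLp 2 (fun pp : Fin 3 => transportSym (fun jj mm =>
          (mFourierCoeff (complexify ∘ u₀)) mm jj) (fun mm => c mm pp) k) : EuclideanSpace ℂ (Fin 3)) +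
        (WithLp.toLp 2 (fun pp : Fin 3 => transportSym (fun jj mm => c mm jj) (fun mm =>
          (mFourierCoeff (complexify ∘ u₀)) mm pp) k) : EuclideanSpace ℂ (Fin 3))) + μ • c k = 0) :
    Torus.IsLinNSEigenvalue ν u₀ μ := by
  obtain ⟨w, hw, hŵ⟩ := linNSResolventRel_of_fourier_eigen hu₀ hdiv₀ μ hc hct hc0 heq
  refine ⟨w, fun hw0 => hcne ?_, hw⟩
  rw [← hŵ, hw0]
  funext k
  simp [mFourierCoeff]


/-! ## §2 The ABC background: the projected linearised symbol in cross-product form -/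

/-- Lattice convolution with a finitely supported LEFT factor is a finite sum. [folklore] -/
theorem lconv_eq_sum_of_support_left {d : Type*} {f g : (d → ℤ) → ℂ} {S : Finset (d → ℤ)}
    (hf : ∀ m ∉ S, f m = 0) (k : d → ℤ) : lconv f g k = ∑ m ∈ S, f m * g (k - m) := by
  rw [lconv_apply, tsum_eq_sum (s := S) (fun m hm => ?_)]
  rw [hf m hm, zero_mul]

/-- Lattice convolution with a finitely supported RIGHT factor is a finite sum (reindexed
`m ↦ k − m`). [folklore] -/
theorem lconv_eq_sum_of_support_right {d : Type*} {f g : (d → ℤ) → ℂ} {S : Finset (d → ℤ)}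
    (hg : ∀ m ∉ S, g m = 0) (k : d → ℤ) : lconv f g k = ∑ m ∈ S, f (k - m) * g m := by
  rw [lconv_apply]
  have h : ∑' m, f m * g (k - m) = ∑' m, f (k - m) * g m := by
    rw [← (Equiv.subLeft k).tsum_eq (fun m => f (k - m) * g m)]
    exact tsum_congr fun m => by simp [Equiv.subLeft_apply]
  rw [h, tsum_eq_sum (s := S) (fun m hm => ?_)]
  rw [hg m hm, mul_zero]

/-- Components of the cross product on `Fin 3 → ℂ`, first. [folklore] -/
theorem cross_fin_zero (u v : Fin 3 → ℂ) : crossProduct u v 0 = u 1 * v 2 - u 2 * v 1 := by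
  simp [cross_apply]

/-- Components of the cross product on `Fin 3 → ℂ`, second. [folklore] -/
theorem cross_fin_one (u v : Fin 3 → ℂ) : crossProduct u v 1 = u 2 * v 0 - u 0 * v 2 := by
  simp [cross_apply]

/-- Components of the cross product on `Fin 3 → ℂ`, third. [folklore] -/
theorem cross_fin_two (u v : Fin 3 → ℂ) : crossProduct u v 2 = u 0 * v 1 - u 1 * v 0 := by
  simp [cross_apply]

/-- **The polarised Lamb identity for one pair of plane waves, at the symbol level** (pure vector
algebra in `ℂ³`, BAC–CAB): for `U, V, s, k′ ∈ ℂ³` and every component `i`,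
`Σ_j (U_j (2πi k′_j) V_i + V_j (2πi s_j) U_i) = 2πi (U·V)(s + k′)_i − 2π [U × (i k′ × V − V)]_i − 2π [V × (i s × U − U)]_i`
— the Fourier form of `(U·∇)W + (W·∇)U = ∇(U·W) − U × curl W − W × curl U` for
`U e^{2πi s·x}`, `W = V e^{2πi k′·x}`, with the Beltrami defect `i s × U − U` of the background
mode kept explicit. [folklore] -/
theorem lamb_pair_symbol (U V s k' : Fin 3 → ℂ) (i : Fin 3) :
    ∑ j : Fin 3, (U j * (2 * Real.pi * Complex.I * k' j) * V i + V j * (2 * Real.pi * Complex.I * s j) * U i) =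
      2 * Real.pi * Complex.I * (∑ j : Fin 3, U j * V j) * (s i + k' i) -
        2 * Real.pi * crossProduct U (Complex.I • crossProduct k' V - V) i -
        2 * Real.pi * crossProduct V (Complex.I • crossProduct s U - U) i := by
  fin_cases i <;>
    simp only [Fin.sum_univ_three, Fin.zero_eta, Fin.mk_one, Fin.reduceFinMk, cross_fin_zero,
      cross_fin_one, cross_fin_two, Pi.sub_apply, Pi.smul_apply, smul_eq_mul] <;> ring

/-- The Beltrami defect of the ABC coefficients vanishes on the shell: `i s × Û(s) = Û(s)` for
`s ∈ {±e_j}` (`Torus.abcCoeff_eigen` in cross-product form). -/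
theorem crossProduct_abcDir_abcCoeff (A B C : ℝ) (y : Fin 3 × Bool) :
    Complex.I • crossProduct (fun j => ((Torus.abcDir y j : ℤ) : ℂ))
        (WithLp.ofLp (Torus.abcCoeff A B C (Torus.abcDir y))) -
      WithLp.ofLp (Torus.abcCoeff A B C (Torus.abcDir y)) = 0 := by
  have h0 := Torus.abcCoeff_eigen A B C y 0
  have h1 := Torus.abcCoeff_eigen A B C y 1
  have h2 := Torus.abcCoeff_eigen A B C y 2
  simp only [show (0 : Fin 3) + 1 = 1 from rfl, show (0 : Fin 3) + 2 = 2 from rfl,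
    show (1 : Fin 3) + 1 = 2 from rfl, show (1 : Fin 3) + 2 = 0 from rfl,
    show (2 : Fin 3) + 1 = 0 from rfl, show (2 : Fin 3) + 2 = 1 from rfl] at h0 h1 h2
  funext i
  fin_cases i
  · simp only [Fin.zero_eta, Pi.sub_apply, Pi.smul_apply, smul_eq_mul, Pi.zero_apply, cross_fin_zero]
    linear_combination h0
  · simp only [Fin.mk_one, Pi.sub_apply, Pi.smul_apply, smul_eq_mul, Pi.zero_apply, cross_fin_one]
    linear_combination h1
  · simp only [Fin.reduceFinMk, Pi.sub_apply, Pi.smul_apply, smul_eq_mul, Pi.zero_apply, cross_fin_two]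
    linear_combination h2

/-- **The linearised convective symbol about the ABC flow, unprojected**: for every Cartesian
coefficient family `c` and frequency `k`, the symbol `N(Û, c)(k) + N(c, Û)(k)` of
`(U·∇)w + (w·∇)U` at `U = Torus.abcFlow A B C` (background coefficients `Û = 𝓕(U)`, supported on the
shell `{±e_j}` where they equal `Torus.abcCoeff`) is a multiple of `k` (a gradient) plus the
cross-product form: `= (2πi Σ_s Û(s)·c(k−s)) k − 2π Σ_{s∈{±e_j}} Û(s) × (i(k−s) × c(k−s) − c(k−s))`. -/
theorem linSym_abcFlow_eq (A B C : ℝ) (c : (Fin 3 → ℤ) → EuclideanSpace ℂ (Fin 3)) (k : Fin 3 → ℤ) :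
    (WithLp.toLp 2 (fun pp : Fin 3 => transportSym (fun jj mm =>
          (mFourierCoeff (complexify ∘ Torus.abcFlow A B C)) mm jj) (fun mm => c mm pp) k) : EuclideanSpace ℂ (Fin 3)) +
        (WithLp.toLp 2 (fun pp : Fin 3 => transportSym (fun jj mm => c mm jj) (fun mm =>
          (mFourierCoeff (complexify ∘ Torus.abcFlow A B C)) mm pp) k) : EuclideanSpace ℂ (Fin 3)) =
      (2 * Real.pi * Complex.I * ∑ s ∈ Torus.abcFreq, ∑ j : Fin 3, Torus.abcCoeff A B C s j * c (k - s) j) •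
          Torus.freqVec k +
        (-(2 * Real.pi : ℂ)) • ∑ s ∈ Torus.abcFreq, (WithLp.toLp 2 (crossProduct (WithLp.ofLp (Torus.abcCoeff A B C s))
          (Complex.I • crossProduct (fun j => (((k - s) j : ℤ) : ℂ)) (WithLp.ofLp (c (k - s))) -
            WithLp.ofLp (c (k - s)))) : EuclideanSpace ℂ (Fin 3)) := by
  set a := Torus.abcCoeff A B C with ha
  have hâ : ∀ m, mFourierCoeff (complexify ∘ Torus.abcFlow A B C) m = if m ∈ Torus.abcFreq then a m else 0 :=
    Torus.mFourierCoeff_abcFlow A B C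
  have hâ0 : ∀ m ∉ Torus.abcFreq, mFourierCoeff (complexify ∘ Torus.abcFlow A B C) m = 0 := fun m hm => by
    rw [hâ m, if_neg hm]
  have hâ1 : ∀ m ∈ Torus.abcFreq, mFourierCoeff (complexify ∘ Torus.abcFlow A B C) m = a m := fun m hm => by
    rw [hâ m, if_pos hm]
  -- the two transport symbols as finite sums over the shell
  have h1 : ∀ pp, transportSym (fun jj mm => (mFourierCoeff (complexify ∘ Torus.abcFlow A B C)) mm jj)
      (fun mm => c mm pp) k = ∑ s ∈ Torus.abcFreq, ∑ jj : Fin 3, a s jj * (dsym jj (k - s) * c (k - s) pp) := by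
    intro pp
    rw [transportSym_apply, Finset.sum_comm]
    refine Finset.sum_congr rfl fun jj _ => ?_
    rw [lconv_eq_sum_of_support_left (S := Torus.abcFreq) (fun m hm => by rw [hâ0 m hm]; rfl)]
    exact Finset.sum_congr rfl fun s hs => by rw [hâ1 s hs]
  have h2 : ∀ pp, transportSym (fun jj mm => c mm jj)
      (fun mm => (mFourierCoeff (complexify ∘ Torus.abcFlow A B C)) mm pp) k =
      ∑ s ∈ Torus.abcFreq, ∑ jj : Fin 3, c (k - s) jj * (dsym jj s * a s pp) := by
    intro pp
    rw [transportSym_apply, Finset.sum_comm]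
    refine Finset.sum_congr rfl fun jj _ => ?_
    rw [lconv_eq_sum_of_support_right (S := Torus.abcFreq) (fun m hm => by rw [hâ0 m hm]; simp)]
    exact Finset.sum_congr rfl fun s hs => by rw [hâ1 s hs]
  -- componentwise
  ext pp
  simp only [PiLp.add_apply, PiLp.smul_apply, smul_eq_mul, h1, h2]
  have hX : (∑ s ∈ Torus.abcFreq, (WithLp.toLp 2 (crossProduct (WithLp.ofLp (a s))
          (Complex.I • crossProduct (fun j => (((k - s) j : ℤ) : ℂ)) (WithLp.ofLp (c (k - s))) -
            WithLp.ofLp (c (k - s)))) : EuclideanSpace ℂ (Fin 3))) pp =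
      ∑ s ∈ Torus.abcFreq, crossProduct (WithLp.ofLp (a s))
          (Complex.I • crossProduct (fun j => (((k - s) j : ℤ) : ℂ)) (WithLp.ofLp (c (k - s))) -
            WithLp.ofLp (c (k - s))) pp := by
    rw [WithLp.ofLp_sum, Finset.sum_apply]
  rw [hX, Torus.freqVec_apply, Finset.mul_sum Torus.abcFreq, Finset.mul_sum Torus.abcFreq,
    Finset.sum_mul Torus.abcFreq, ← Finset.sum_add_distrib, ← Finset.sum_add_distrib]
  refine Finset.sum_congr rfl fun s hs => ?_
  obtain ⟨y, hy⟩ := Torus.mem_abcFreq.mp hs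
  have hB := crossProduct_abcDir_abcCoeff A B C y
  rw [hy, ← ha] at hB
  have hL := lamb_pair_symbol (WithLp.ofLp (a s)) (WithLp.ofLp (c (k - s))) (fun j => ((s j : ℤ) : ℂ))
    (fun j => (((k - s) j : ℤ) : ℂ)) pp
  beta_reduce at hL
  rw [hB, LinearMap.map_zero, Pi.zero_apply, mul_zero, sub_zero] at hL
  have hks : ((s pp : ℤ) : ℂ) + (((k - s) pp : ℤ) : ℂ) = ((k pp : ℤ) : ℂ) := by
    rw [Pi.sub_apply]; push_cast; ring
  rw [hks] at hL
  have hL' : ∑ jj : Fin 3, a s jj * (dsym jj (k - s) * c (k - s) pp) +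
      ∑ jj : Fin 3, c (k - s) jj * (dsym jj s * a s pp) =
      ∑ j : Fin 3, (WithLp.ofLp (a s) j * (2 * Real.pi * Complex.I * (((k - s) j : ℤ) : ℂ)) *
          WithLp.ofLp (c (k - s)) pp +
        WithLp.ofLp (c (k - s)) j * (2 * Real.pi * Complex.I * ((s j : ℤ) : ℂ)) * WithLp.ofLp (a s) pp) := by
    rw [← Finset.sum_add_distrib]
    refine Finset.sum_congr rfl fun j _ => ?_
    rw [dsym_apply, dsym_apply]
    ring
  rw [hL', hL]
  ring

/-- **The projected linearised symbol about the ABC flow is the cross-product form** (KERNEL-CHAIN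
(A2), operator half, Cartesian coordinates): for every `c` and `k`,
`Π_k (N(Û, c) + N(c, Û))(k) = −2π · Π_k Σ_{s∈{±e_j}} Û(s) × (i(k−s) × c(k−s) − c(k−s))`
(`Π_k k = 0` removes the gradient part of `linSym_abcFlow_eq`). This is the operator the X0
certifiers assemble (METHOD-I4 §1: `⟨(x − L) f′e^{ik′·x}, f e^{ik·x}⟩ = −(Û(k − k′) × (ik′ × f′ − f′))·f`,
`s = k − k′`), up to the factor `2π` of the unit-torus normalisation. -/
theorem lerayCoeff_linSym_abcFlow (A B C : ℝ) (c : (Fin 3 → ℤ) → EuclideanSpace ℂ (Fin 3)) (k : Fin 3 → ℤ) :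
    Torus.lerayCoeff k ((WithLp.toLp 2 (fun pp : Fin 3 => transportSym (fun jj mm =>
          (mFourierCoeff (complexify ∘ Torus.abcFlow A B C)) mm jj) (fun mm => c mm pp) k) : EuclideanSpace ℂ (Fin 3)) +
        (WithLp.toLp 2 (fun pp : Fin 3 => transportSym (fun jj mm => c mm jj) (fun mm =>
          (mFourierCoeff (complexify ∘ Torus.abcFlow A B C)) mm pp) k) : EuclideanSpace ℂ (Fin 3))) =
      (-(2 * Real.pi : ℂ)) • Torus.lerayCoeff k (∑ s ∈ Torus.abcFreq, (WithLp.toLp 2 (crossProduct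
          (WithLp.ofLp (Torus.abcCoeff A B C s))
          (Complex.I • crossProduct (fun j => (((k - s) j : ℤ) : ℂ)) (WithLp.ofLp (c (k - s))) -
            WithLp.ofLp (c (k - s)))) : EuclideanSpace ℂ (Fin 3))) := by
  rw [linSym_abcFlow_eq, lerayCoeff_add', lerayCoeff_smul', lerayCoeff_smul', lerayCoeff_freqVec, smul_zero,
    zero_add]

/-! ## §3 The certifiers' eigen-equation gives a classical eigenpair of the linearisation about the ABC flow -/

/-- **ASSEMBLY (A6) + (A2)-operator, Cartesian form.** Let `R > 0`, `λ ∈ ℂ`, and let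
`c : ℤ³ → ℂ³` be rapidly decaying, transversal (`k·c(k) = 0`), with `c(0) = 0`, `c ≠ 0`, and
satisfy THE CERTIFIERS' EIGEN-EQUATION on `(ℝ/2πℤ)³` with `ν = 1/R`
(METHOD-I4 §1 / INSTAB3-METHOD; `U = ` the ABC flow with `curl U = U`, `Û = Torus.abcCoeff` on `{±e_j}`):
`−(|k|²/R) c(k) + P_k Σ_{s∈{±e_j}} Û(s) × (i(k−s) × c(k−s) − c(k−s)) = λ c(k)` for every `k`.
Then `2πλ` is an eigenvalue of the tree's linearised Navier–Stokes operator about `Torus.abcFlow A B C`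
on the UNIT torus with viscosity `1/(2πR)`: `Torus.IsLinNSEigenvalue (1/(2πR)) (Torus.abcFlow A B C) (2πλ)`
(the rescaling `x = 2πy`: `L_unit = 2π·L_R`). What is NOT discharged here: that the certified class-II
Galerkin data produce such a `c` (KERNEL-CHAIN (A2) matrix ↔ Craya coordinates, (A3)–(A5), and
the CERTIFIER AUDIT). -/
theorem isLinNSEigenvalue_abcFlow_of_certifier_eigen (A B C : ℝ) {R : ℝ} (hR : 0 < R) (lam : ℂ)
    {c : (Fin 3 → ℤ) → EuclideanSpace ℂ (Fin 3)} (hc : RapidDecay c)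
    (hct : ∀ k : Fin 3 → ℤ, (∑ jj : Fin 3, ((k jj : ℤ) : ℂ) * (c k) jj) = 0) (hc0 : c 0 = 0)
    (hcne : c ≠ 0)
    (hL : ∀ k : Fin 3 → ℤ, ((-(freqNormSq k / R) : ℝ) : ℂ) • c k +
      Torus.lerayCoeff k (∑ s ∈ Torus.abcFreq, (WithLp.toLp 2 (crossProduct
          (WithLp.ofLp (Torus.abcCoeff A B C s))
          (Complex.I • crossProduct (fun j => (((k - s) j : ℤ) : ℂ)) (WithLp.ofLp (c (k - s))) -
            WithLp.ofLp (c (k - s)))) : EuclideanSpace ℂ (Fin 3))) = lam • c k) :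
    Torus.IsLinNSEigenvalue (1 / (2 * Real.pi * R)) (Torus.abcFlow A B C) (2 * Real.pi * lam) := by
  refine isLinNSEigenvalue_of_fourier_eigen (Torus.isSmooth_abcFlow A B C) (Torus.isDivFree_abcFlow A B C)
    (2 * Real.pi * lam) hc hct hc0 hcne fun k => ?_
  rw [lerayCoeff_linSym_abcFlow]
  have hPX : Torus.lerayCoeff k (∑ s ∈ Torus.abcFreq, (WithLp.toLp 2 (crossProduct
          (WithLp.ofLp (Torus.abcCoeff A B C s))
          (Complex.I • crossProduct (fun j => (((k - s) j : ℤ) : ℂ)) (WithLp.ofLp (c (k - s))) -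
            WithLp.ofLp (c (k - s)))) : EuclideanSpace ℂ (Fin 3))) =
      lam • c k - ((-(freqNormSq k / R) : ℝ) : ℂ) • c k := by
    rw [← hL k, add_sub_cancel_left]
  rw [hPX]
  have hπ : (Real.pi : ℝ) ≠ 0 := Real.pi_ne_zero
  have hν : (((1 / (2 * Real.pi * R)) * (4 * Real.pi ^ 2 * freqNormSq k) : ℝ) : ℂ) =
      (2 * Real.pi : ℂ) * ((freqNormSq k / R : ℝ) : ℂ) := by
    have h : (1 / (2 * Real.pi * R)) * (4 * Real.pi ^ 2 * freqNormSq k) = 2 * Real.pi * (freqNormSq k / R) := by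
      field_simp
      ring
    rw [h]; push_cast; ring
  rw [hν]
  push_cast
  module

/-! ## §4 Rung R-α from the certifiers' eigen-equation -/

/-- **R-α from the certifiers' equation** (conditional on the named fact FPS06, as
`AbcLyapunovInstability.isLyapunovUnstable_abcFlow_of_eigenvalue`): if in addition `0 < Re λ`, the
ABC flow is a Lyapunov-unstable steady state of the TRUE forced Navier–Stokes system on the unit
torus with viscosity `ν = 1/(2πR)` and force `4π²ν·U`. MODEL-to-NS bookkeeping only: the
hypothesis `c` is exactly what the X0 certificates are meant to produce (a real class-II
eigenvalue `λ = X0(R) > 0`); nothing here asserts that they do. -/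
theorem isLyapunovUnstable_abcFlow_of_certifier_eigen
    (hFPS : Torus.fps2006_nonlinear_instability_of_eigenvalue) (A B C : ℝ) {R : ℝ} (hR : 0 < R)
    {lam : ℂ} (hlam : 0 < lam.re)
    {c : (Fin 3 → ℤ) → EuclideanSpace ℂ (Fin 3)} (hc : RapidDecay c)
    (hct : ∀ k : Fin 3 → ℤ, (∑ jj : Fin 3, ((k jj : ℤ) : ℂ) * (c k) jj) = 0) (hc0 : c 0 = 0)
    (hcne : c ≠ 0)
    (hL : ∀ k : Fin 3 → ℤ, ((-(freqNormSq k / R) : ℝ) : ℂ) • c k +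
      Torus.lerayCoeff k (∑ s ∈ Torus.abcFreq, (WithLp.toLp 2 (crossProduct
          (WithLp.ofLp (Torus.abcCoeff A B C s))
          (Complex.I • crossProduct (fun j => (((k - s) j : ℤ) : ℂ)) (WithLp.ofLp (c (k - s))) -
            WithLp.ofLp (c (k - s)))) : EuclideanSpace ℂ (Fin 3))) = lam • c k) :
    Torus.IsLyapunovUnstableSteadyState (1 / (2 * Real.pi * R))
      (fun x => (4 * Real.pi ^ 2 * (1 / (2 * Real.pi * R))) • Torus.abcFlow A B C x)
      (Torus.abcFlow A B C) := by
  have hν : 0 < 1 / (2 * Real.pi * R) := by positivity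
  have hμ : 0 < (2 * Real.pi * lam : ℂ).re := by
    rw [show (2 * Real.pi * lam : ℂ) = ((2 * Real.pi : ℝ) : ℂ) * lam by push_cast; ring,
      Complex.re_ofReal_mul]
    positivity
  exact AbcLyapunovInstability.isLyapunovUnstable_abcFlow_of_eigenvalue hFPS hν A B C hμ
    (isLinNSEigenvalue_abcFlow_of_certifier_eigen A B C hR lam hc hct hc0 hcne hL)

end Summit.NavierStokesRegularity.FluidComputer.AbcLatticeEigenSynthesis

end
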